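import Literature.MathematicalPhysics.QuantumLattice.HubbardTorusLocalCertificate
import Literature.MathematicalPhysics.QuantumLattice.HubbardTorusLocalHamiltonianDecomposition
import Literature.MathematicalPhysics.QuantumLattice.InfVolFermionStateHubbardEnergy
import Literature.MathematicalPhysics.QuantumLattice.HubbardEnergyDensityCertificateLimit
import Literature.MathematicalPhysics.QuantumLattice.HubbardSpinChargeCertificate
import HarnessLib

/-!
# Window ("reduce"-mode, thermodynamic-limit) bootstrap certificates for the Hubbard model:
# one identity in the CAR algebra of a finite window bounds the energy per site of EVERY large torus,
# hence the thermodynamic-limit energy density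

Family `hubbard` (topic `MathematicalPhysics/QuantumLattice`). X. Han's translation-invariant
many-body bootstrap (arXiv:2006.06002 (2020) §2–3) and its exact rational certificates (bundle
papers/HubbardSuperconductivity/manybody-bootstrap/, format `certsdp/1` §3 mode `reduce`) produce
ONE identity in the local CAR algebra `𝔄_{Λ'} = FermionOp Λ'` of a finite window `Λ' ⊆ ℤ^d`:

  `E_Φ − c·1 − Σ_σ μ_σ (n_{0σ} − ν·1)
     = Σ Λₐᵦ Oₐᴴ O_b + (Σₖ [H_{Λ'}, Bₖ] + Σₗ (τ_{vₗ} Yₗ − Yₗ) + Σⱼ bⱼ • wⱼ) + (Σₘ dₘ • (Vₘᴴ − Vₘ) + Σₖ aₖ • vₖ)`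

(`E_Φ` = the mean-energy observable of the Hubbard interaction, whose translates sum to the
Hamiltonian; `H_{Λ'}` the free-boundary Hamiltonian of the window, `Bₖ, Yₗ` supported in an inner
region `Λ` all of whose lattice neighbours lie in `Λ'`; `τ_v` lattice translations inside the window;
`wⱼ` CHARGED ladder words (particle or spin charge `≠ 0`); `dₘ` real; `vₖ` ladder words). Pulling
the window back into the fermionic torus `(ℤ/Lℤ)^d` by `x ↦ x mod L` (`PolySite.toTorusEmb`, the
`*`-homomorphism `fermionEmbed`; injective on `thicken Λ' 1` for all large `L`,
`exists_forall_le_injOn_proj`) turns every bracket into a null term of the tracial sector ground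
state of the torus — `[H_L, Γ B]` (`hubbardTorus_commutator_fermionEmbed`), `U_v (Γ Y) U_vᴴ − Γ Y`
(`fermionEmbed_toTorusEmb_shiftEmb`), commutators with `N̂` / `S^z` (`totalNumber_comm_ladderWord`,
`spinZ_comm_ladderWord`), anti-Hermitian parts — so that
`hubbardTorus_groundEnergyAt_div_ge_of_local_certificate` (HubbardTorusLocalCertificate) gives, for
EVERY `L` with `x ↦ x mod L` injective on `thicken Λ' 1` and every even particle number `2n ≤ 2L^d`,

  `c − Σₖ ‖aₖ‖ + (Σ_σ μ_σ)(n/L^d − ν) ≤ groundEnergyAt (fermionTorusGraph d L) t U (2n) / L^d`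

(`groundEnergyAt_div_ge_of_window_certificate`), and in `d = 2`, along `N_L = 2⌊nL²/2⌋`, the
thermodynamic-limit bound `c − Σₖ ‖aₖ‖ ≤ energyDensity2D t U n`
(`energyDensity2D_ge_of_window_certificate`, via `energyDensity2D_ge_of_eventually_ge_torus`).
This is the soundness theorem that makes a reduce-mode certificate a statement about the tree's
`energyDensity2D`; the only non-kernel input left is the window identity itself (exact CAR
arithmetic, checked by the bundle's verifiers). Everything is PROVED; the one definition is the
bookkeeping map `Orb.embMap` (letters of a word under a site embedding).

## References
* X. Han, *Quantum many-body bootstrap*, arXiv:2006.06002 (2020), §2 eq. (2)–(8), §3 (2D Hubbard,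
  thermodynamic limit, constraints `F[[H,O]] = 0`, `F[U⁻¹OU] = F[O]`, density fixed by `F[n_x] = n`).
  [cite: Han2020Bootstrap, §3]
* O. Bratteli, D. W. Robinson, *Operator Algebras and Quantum Statistical Mechanics II*, 2nd ed.,
  §5.2.2 (isotony / covariance of local CAR algebras), §6.2.4 (periodic states, mean energy).
  [cite: BratteliRobinsonII1997, §6.2.4]
* D. Ruelle, *Statistical Mechanics* (1969), §3.3 (thermodynamic limit of the ground-state energy
  density; tree `tendsto_energyDensity2D`). [cite: Ruelle1969, §3.3]
-/

noncomputable section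

namespace Literature.MathematicalPhysics.QuantumLattice

open Matrix Finset HubbardWave0 Literature.Probability.LatticeModels
open Literature.MathematicalPhysics.QuantumManyBody.StateRelaxation
open scoped ComplexOrder BigOperators

/-! ### Ladder words under a site embedding; the particle-number charge of a word -/

section Embedding

variable {Λ Λ' : Type*} [LinearOrder Λ] [Fintype Λ] [LinearOrder Λ'] [Fintype Λ']

omit [LinearOrder Λ] [Fintype Λ] [LinearOrder Λ'] [Fintype Λ'] in
/-- The orbital map `(x, σ) ↦ (φ x, σ)` of a site embedding (the action of `Γ(φ)` on generators).
[folklore] -/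
def Orb.embMap (φ : Λ ↪ Λ') (i : Orb Λ) : Orb Λ' := orb (φ (ofLex i).1) (ofLex i).2

omit [LinearOrder Λ] [Fintype Λ] [LinearOrder Λ'] [Fintype Λ'] in
/-- The spin of `Orb.embMap φ i` is the spin of `i`. [folklore] -/
@[simp] theorem Orb.ofLex_embMap_snd (φ : Λ ↪ Λ') (i : Orb Λ) : (ofLex (Orb.embMap φ i)).2 = (ofLex i).2 :=
  rfl

/-- `Γ(φ)` maps the ladder letter `(i, dag)` to the ladder letter `(φ i, dag)`. [folklore] -/
theorem fermionEmbed_ladderLetter (φ : Λ ↪ Λ') (p : Orb Λ × Bool) :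
    fermionEmbed φ (ladderLetter p) = ladderLetter (Orb.embMap φ p.1, p.2) := by
  obtain ⟨i, b⟩ := p
  cases b
  · simp only [ladderLetter, Bool.false_eq_true, if_false]
    exact fermionEmbed_annihilation' φ i
  · simp only [ladderLetter, if_true]
    exact fermionEmbed_creation' φ i

/-- **`Γ(φ)` maps ladder words to ladder words** (letterwise). [cite: BratteliRobinsonII1997, §5.2.2] -/
theorem fermionEmbed_ladderWord (φ : Λ ↪ Λ') (l : List (Orb Λ × Bool)) :
    fermionEmbed φ (ladderWord l) = ladderWord (l.map fun p => (Orb.embMap φ p.1, p.2)) := by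
  induction l with
  | nil => simp
  | cons p l ih => rw [ladderWord_cons, map_mul, fermionEmbed_ladderLetter, ih, List.map_cons, ladderWord_cons]

omit [LinearOrder Λ] [Fintype Λ] [LinearOrder Λ'] [Fintype Λ'] in
/-- The particle charge of a word is unchanged by a site embedding. [folklore] -/
@[simp] theorem ladderCharge_map_embMap (φ : Λ ↪ Λ') (l : List (Orb Λ × Bool)) :
    ladderCharge (l.map fun p => (Orb.embMap φ p.1, p.2)) = ladderCharge l := by
  induction l with
  | nil => simp
  | cons p l ih => simp [ih]

omit [LinearOrder Λ] [Fintype Λ] [LinearOrder Λ'] [Fintype Λ'] in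
/-- The spin charge of a word is unchanged by a site embedding. [folklore] -/
@[simp] theorem ladderSpinCharge_map_embMap (φ : Λ ↪ Λ') (l : List (Orb Λ × Bool)) :
    ladderSpinCharge (l.map fun p => (Orb.embMap φ p.1, p.2)) = ladderSpinCharge l := by
  induction l with
  | nil => simp
  | cons p l ih =>
    rw [List.map_cons, ladderSpinCharge_cons, ladderSpinCharge_cons, ih]
    simp [letterSpinCharge, Orb.embMap]

/-- **Particle charge of a ladder letter**: `[N̂, c†_i] = c†_i`, `[N̂, c_i] = −c_i`. [folklore] -/
theorem totalNumber_comm_ladderLetter (p : Orb Λ × Bool) :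
    totalNumber * ladderLetter p - ladderLetter p * totalNumber =
      (((if p.2 then (1 : ℤ) else -1 : ℤ) : ℂ)) • ladderLetter p := by
  classical
  obtain ⟨i, b⟩ := p
  rw [totalNumber_eq_numberDiag_univ, orbs_univ]
  cases b
  · simp only [ladderLetter, Bool.false_eq_true, if_false]
    rw [numberDiag_comm_annihilation, if_pos (Finset.mem_univ i)]
    norm_num
  · simp only [ladderLetter, if_true]
    rw [numberDiag_comm_creation, if_pos (Finset.mem_univ i)]
    norm_num

/-- **Particle charge of a ladder word**: `N̂ w − w N̂ = (ladderCharge w) · w`. [folklore] -/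
theorem totalNumber_comm_ladderWord (l : List (Orb Λ × Bool)) :
    totalNumber * ladderWord l - ladderWord l * totalNumber = ((ladderCharge l : ℤ) : ℂ) • ladderWord l := by
  induction l with
  | nil => simp
  | cons p l ih =>
    rw [ladderWord_cons, comm_mul_of_comm_eq_smul (totalNumber_comm_ladderLetter p) ih, ladderCharge_cons]
    push_cast
    rfl

/-- `Γ(φ)` maps Gram elements to Gram elements: `Γ(Σ Λᵢⱼ Oᵢᴴ Oⱼ) = Σ Λᵢⱼ (Γ Oᵢ)ᴴ (Γ Oⱼ)`
(`Γ` is a unital `*`-homomorphism). [cite: BratteliRobinsonII1997, §5.2.2] -/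
theorem fermionEmbed_gramForm (φ : Λ ↪ Λ') {m : Type*} [Fintype m] (Λm : Matrix m m ℂ)
    (O : m → Matrix (Finset (Orb Λ)) (Finset (Orb Λ)) ℂ) :
    fermionEmbed φ (gramForm Λm O) = gramForm Λm (fun i => fermionEmbed φ (O i)) := by
  simp only [gramForm, map_sum, map_smul, map_mul, star_eq_conjTranspose, fermionEmbed_conjTranspose]

end Embedding

/-! ### The window pulled back into a torus: dictionary of null terms -/

section Window

variable {d L : ℕ} [NeZero L]

/-- (Local to this file, as in `HubbardTorusLocalCertificate` / `DopedRVBState`.) Torus sites are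
compared through the linear order, the instance carried by the orbital-generic lemmas. [folklore] -/
local instance (priority := high) instDecidableEqFermionTorusWindow : DecidableEq (FermionTorus d L) :=
  LinearOrder.toDecidableEq

/-- **Isotony then pull-back = pull-back of the smaller region**: `Γ(ι_{Λ'}) (Γ(incl) Z) = Γ(ι_S) Z`
for `S ⊆ Λ'` (functoriality of `Γ`). [cite: BratteliRobinsonII1997, §5.2.2] -/
theorem fermionEmbed_toTorusEmb_incl {S Λ' : Finset (Site d)} (hS : S ⊆ Λ')
    (hInj' : Set.InjOn (Torus.proj (d := d) L) ↑Λ') (Z : FermionOp S) :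
    fermionEmbed (PolySite.toTorusEmb L hInj') (fermionEmbed (PolySite.incl hS) Z) =
      fermionEmbed (PolySite.toTorusEmb L (hInj'.mono (by exact_mod_cast hS))) Z := by
  rw [fermionEmbed_fermionEmbed]
  exact congrFun (congrArg DFunLike.coe (fermionEmbed_congr fun p => rfl)) Z

/-- **Translation differences in the window become symmetry defects on the torus**:
`Γ(ι_{Λ'})(Γ(incl)(Γ(τ_v) Y) − Γ(incl) Y) = U_{v mod L} (Γ(ι_Λ) Y) U_{v mod L}ᴴ − Γ(ι_Λ) Y`.
Han 2020 §2 eq. (2) (`F[U⁻¹ O U] = F[O]` for lattice translations `U`).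
[cite: Han2020Bootstrap, §2 eq. (2)] -/
theorem fermionEmbed_toTorusEmb_shift_sub {Λ Λ' : Finset (Site d)} (hΛ : Λ ⊆ Λ') (v : Site d)
    (hsh : shiftSet v Λ ⊆ Λ') (hInj' : Set.InjOn (Torus.proj (d := d) L) ↑Λ') (Y : FermionOp Λ) :
    fermionEmbed (PolySite.toTorusEmb L hInj')
        (fermionEmbed (PolySite.incl hsh) (fermionEmbed (PolySite.shiftEmb v Λ) Y) -
          fermionEmbed (PolySite.incl hΛ) Y) =
      (fockTranslate (Torus.proj L v)).val *
          fermionEmbed (PolySite.toTorusEmb L (hInj'.mono (by exact_mod_cast hΛ))) Y *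
          (fockTranslate (Torus.proj L v)).valᴴ -
        fermionEmbed (PolySite.toTorusEmb L (hInj'.mono (by exact_mod_cast hΛ))) Y := by
  rw [map_sub, fermionEmbed_toTorusEmb_incl hsh hInj', fermionEmbed_toTorusEmb_incl hΛ hInj',
    fermionEmbed_toTorusEmb_shiftEmb L v (hInj'.mono (by exact_mod_cast hΛ)) (hInj'.mono (by exact_mod_cast hsh)) Y,
    relabel_eq_fockRelabel_conj]

/-- The pulled-back density `Γ(ι)(n_{0σ})` is the torus number operator at the origin. [folklore] -/
theorem fermionEmbed_toTorusEmb_nAt_zero {Λ' : Finset (Site d)} (hz : (0 : Site d) ∈ Λ')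
    (hInj' : Set.InjOn (Torus.proj (d := d) L) ↑Λ') (σ : Fin 2) :
    fermionEmbed (PolySite.toTorusEmb L hInj') (nAt 0 hz σ) =
      numberOp (FermionTorus.ofTorusSite (0 : TorusSite d L)) σ := by
  have hproj : Torus.proj L (0 : Site d) = 0 := by funext i; simp [Torus.proj]
  rw [nAt, fermionEmbed_numberOp, PolySite.toTorusEmb_pt, hproj]

/-- A CHARGED ladder word of the torus is a commutator with a conserved charge:
`b • w = C W − W C` with `C = N̂` (if the particle charge `q ≠ 0`, `W = (b/q) • w`) or `C = S^z`
(if the spin charge `2s ≠ 0`, `W = (b/s) • w`). Han 2020 §2. [cite: Han2020Bootstrap, §2] -/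
theorem smul_ladderWord_eq_commutator_of_charged {Λ : Type*} [LinearOrder Λ] [Fintype Λ]
    (b : ℂ) (l : List (Orb Λ × Bool)) (hl : ladderCharge l ≠ 0 ∨ ladderSpinCharge l ≠ 0) :
    b • ladderWord l =
      (if ladderCharge l ≠ 0 then (totalNumber : Matrix (Finset (Orb Λ)) (Finset (Orb Λ)) ℂ)
        else HubbardWave0.spinZ) *
          ((b / (if ladderCharge l ≠ 0 then ((ladderCharge l : ℤ) : ℂ)
            else ((ladderSpinCharge l : ℤ) : ℂ) / 2)) • ladderWord l) -
        ((b / (if ladderCharge l ≠ 0 then ((ladderCharge l : ℤ) : ℂ)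
            else ((ladderSpinCharge l : ℤ) : ℂ) / 2)) • ladderWord l) *
          (if ladderCharge l ≠ 0 then (totalNumber : Matrix (Finset (Orb Λ)) (Finset (Orb Λ)) ℂ)
            else HubbardWave0.spinZ) := by
  by_cases hq : ladderCharge l ≠ 0
  · simp only [hq, ne_eq, not_false_eq_true, if_true]
    rw [Matrix.mul_smul, Matrix.smul_mul, ← smul_sub, totalNumber_comm_ladderWord, smul_smul]
    congr 1
    have hq' : ((ladderCharge l : ℤ) : ℂ) ≠ 0 := Int.cast_ne_zero.mpr hq
    field_simp
  · have hs : ladderSpinCharge l ≠ 0 := hl.resolve_left hq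
    simp only [hq, if_false]
    rw [Matrix.mul_smul, Matrix.smul_mul, ← smul_sub, spinZ_comm_ladderWord, smul_smul]
    congr 1
    have hs' : ((ladderSpinCharge l : ℤ) : ℂ) ≠ 0 := Int.cast_ne_zero.mpr hs
    field_simp

/-! ### The window certificate on a fixed torus -/

/-- **Window certificate ⇒ energy per site of a torus.** Data: a window `Λ' ⊆ ℤ^d` containing
`[-1,1]^d` (so that the mean-energy observable `E_Φ` of the Hubbard interaction and the densities
`n_{0σ}` live in it) and an inner region `Λ ⊆ Λ'` all of whose lattice neighbours lie in `Λ'`; an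
identity in `𝔄_{Λ'}`
`Γ(incl) E_Φ − c·1 − Σ_σ μ_σ (n_{0σ} − ν·1) = Σ Λₐᵦ Oₐᴴ O_b + (Σₖ (H_{Λ'} Bₖ − Bₖ H_{Λ'})
   + Σₗ (Γ(incl)(Γ(τ_{vₗ}) Yₗ) − Γ(incl) Yₗ) + Σⱼ bⱼ • wⱼ) + (Σₘ dₘ • (Vₘᴴ − Vₘ) + Σₖ aₖ • vₖ)`
with `Λ ⪰ 0`, `Bₖ = Γ(incl) B⁰ₖ`, `B⁰ₖ, Yₗ ∈ 𝔄_Λ`, translations `vₗ` with `Λ + vₗ ⊆ Λ'`, charged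
ladder words `wⱼ` (`ladderCharge ≠ 0 ∨ ladderSpinCharge ≠ 0`), real `dₘ`, ladder words `vₖ`. Then
for every torus side `L ≥ 3` with `x ↦ x mod L` injective on `thicken Λ' 1` and every `n ≤ L^d`:
`c − Σₖ ‖aₖ‖ + (Σ_σ μ_σ)(n/L^d − ν) ≤ groundEnergyAt (fermionTorusGraph d L) t U (2n) / L^d`.
Han 2020 §2–3 (translation-invariant bootstrap, `F[[H,O]] = 0`, `F[n_x] = n`, charges), read on the
periodic box through the tracial sector ground state. Lattice point-group reductions are not
covered by this statement (they enter `hubbardTorus_groundEnergyAt_div_ge_of_local_certificate` as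
further symmetry defects `U Y Uᴴ − Y`). [cite: Han2020Bootstrap, §3] -/
theorem groundEnergyAt_div_ge_of_window_certificate (t U : ℝ) (hL : 3 ≤ L) {nh : ℕ}
    (hn : nh ≤ Fintype.card (FermionTorus d L))
    {Λ Λ' : Finset (Site d)} (hΛ : Λ ⊆ Λ')
    (hclosed : ∀ x ∈ Λ, ∀ i : Fin d, x + unitVec i ∈ Λ' ∧ x - unitVec i ∈ Λ')
    (h0 : thicken ({0} : Finset (Site d)) 1 ⊆ Λ') (hz : (0 : Site d) ∈ Λ')
    (hInj : Set.InjOn (Torus.proj (d := d) L) ↑(thicken Λ' 1))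
    (μ : Fin 2 → ℝ) (ν : ℝ)
    {m : Type*} [Fintype m] [DecidableEq m] {Λm : Matrix m m ℂ} (hΛm : Λm.PosSemidef)
    (O : m → FermionOp Λ')
    {κ : Type*} (s : Finset κ) (B : κ → FermionOp Λ)
    {ι : Type*} (tt : Finset ι) (v : ι → Site d) (hsh : ∀ l, shiftSet (v l) Λ ⊆ Λ') (Y : ι → FermionOp Λ)
    {γ : Type*} (u : Finset γ) (b : γ → ℂ) (cw : γ → List (Orb (PolySite Λ') × Bool))
    (hcw : ∀ j ∈ u, ladderCharge (cw j) ≠ 0 ∨ ladderSpinCharge (cw j) ≠ 0)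
    {δ : Type*} (ah : Finset δ) (dc : δ → ℝ) (V : δ → FermionOp Λ')
    {κ'' : Type*} (w : Finset κ'') (a : κ'' → ℂ) (word : κ'' → List (Orb (PolySite Λ') × Bool)) {c : ℝ}
    (hcert : fermionEmbed (PolySite.incl h0) ((hubbardFermionInteraction d t U).meanEnergyObs 1) -
        (c : ℂ) • (1 : FermionOp Λ') -
        ∑ σ : Fin 2, ((μ σ : ℝ) : ℂ) • (nAt 0 hz σ - ((ν : ℝ) : ℂ) • (1 : FermionOp Λ')) =
      gramForm Λm O +
        (∑ k ∈ s, ((hubbardFermionInteraction d t U).localHamiltonian Λ' * fermionEmbed (PolySite.incl hΛ) (B k) -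
            fermionEmbed (PolySite.incl hΛ) (B k) * (hubbardFermionInteraction d t U).localHamiltonian Λ') +
          ∑ l ∈ tt, (fermionEmbed (PolySite.incl (hsh l)) (fermionEmbed (PolySite.shiftEmb (v l) Λ) (Y l)) -
            fermionEmbed (PolySite.incl hΛ) (Y l)) +
          ∑ j ∈ u, b j • ladderWord (cw j)) +
        (∑ m' ∈ ah, ((dc m' : ℝ) : ℂ) • ((V m')ᴴ - V m') + ∑ k ∈ w, a k • ladderWord (word k))) :
    c - ∑ k ∈ w, ‖a k‖ + (∑ σ : Fin 2, μ σ) * ((nh : ℝ) / (L : ℝ) ^ d - ν) ≤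
      groundEnergyAt (fermionTorusGraph d L) t U (2 * nh) / (L : ℝ) ^ d := by
  -- the pull-back homomorphism and its restrictions
  have hInj' : Set.InjOn (Torus.proj (d := d) L) ↑Λ' := hInj.mono (by exact_mod_cast subset_thicken Λ' 1)
  have hInjΛ : Set.InjOn (Torus.proj (d := d) L) ↑Λ := hInj'.mono (by exact_mod_cast hΛ)
  have hInj0 : Set.InjOn (Torus.proj (d := d) L) ↑(thicken ({0} : Finset (Site d)) 1) :=
    hInj'.mono (by exact_mod_cast h0)
  set Γ' := fermionEmbed (PolySite.toTorusEmb L hInj') with hΓ'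
  set ΓΛ := fermionEmbed (PolySite.toTorusEmb L hInjΛ) with hΓΛ
  set H := hubbardTorus d L t U with hH
  set EΦ := (hubbardFermionInteraction d t U).meanEnergyObs 1 with hEΦ
  -- the objective: `Γ' (Γ(incl) E_Φ) = Γ(ι₀) E_Φ`, whose translates sum to `H`
  set X := Γ' (fermionEmbed (PolySite.incl h0) EΦ) with hX
  have hX0 : X = fermionEmbed (PolySite.toTorusEmb L hInj0) EΦ := fermionEmbed_toTorusEmb_incl h0 hInj' EΦ
  have hsum : ∑ v' : TorusSite d L, (fockTranslate v').val * X * (fockTranslate v').valᴴ = H := by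
    rw [hX0]
    have h := sum_relabel_translate_hubbard_meanEnergyObs (d := d) t U hL
    simp_rw [relabel_eq_fockRelabel_conj] at h
    exact h
  -- density observables
  set D : Fin 2 → Matrix (Finset (Orb (FermionTorus d L))) (Finset (Orb (FermionTorus d L))) ℂ :=
    fun σ => numberOp (FermionTorus.ofTorusSite (0 : TorusSite d L)) σ with hD
  set G : Fin 2 → Matrix (Finset (Orb (FermionTorus d L))) (Finset (Orb (FermionTorus d L))) ℂ :=
    fun σ => ∑ y : FermionTorus d L, numberOp y σ with hG
  have hDΓ : ∀ σ, Γ' (nAt 0 hz σ) = D σ := fun σ => fermionEmbed_toTorusEmb_nAt_zero hz hInj' σ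
  have hDsum : ∀ σ ∈ (Finset.univ : Finset (Fin 2)),
      ∑ v' : TorusSite d L, (fockTranslate v').val * D σ * (fockTranslate v').valᴴ = G σ :=
    fun σ _ => sum_conj_fockTranslate_numberOp 0 σ
  have hGh : ∀ σ ∈ (Finset.univ : Finset (Fin 2)), (G σ).IsHermitian := fun σ _ => isHermitian_sum_numberOp σ
  have hGs : ∀ σ ∈ (Finset.univ : Finset (Fin 2)),
      ∀ ψ ∈ (szSector (2 * nh) 0 : Submodule ℂ (Fock (Orb (FermionTorus d L)))),
        G σ *ᵥ ψ = (((nh : ℝ) : ℝ) : ℂ) • ψ := by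
    intro σ _ ψ hψ
    rw [hG, spinNumber_mulVec_of_mem_szSector σ hψ]
    congr 1
    push_cast
    ring
  -- symmetry (translation) family
  set Us : ι → Matrix (Finset (Orb (FermionTorus d L))) (Finset (Orb (FermionTorus d L))) ℂ :=
    fun l => (fockTranslate (Torus.proj L (v l))).val with hUs
  set Yt : ι → Matrix (Finset (Orb (FermionTorus d L))) (Finset (Orb (FermionTorus d L))) ℂ :=
    fun l => ΓΛ (Y l) with hYt
  have hU : ∀ l ∈ tt, Us l * H = H * Us l := fun l _ => fockTranslate_mul_hubbardTorus _ t U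
  have hUK : ∀ l ∈ tt, ∀ ψ ∈ (szSector (2 * nh) 0 : Submodule ℂ (Fock (Orb (FermionTorus d L)))),
      Us l *ᵥ ψ ∈ (szSector (2 * nh) 0 : Submodule ℂ (Fock (Orb (FermionTorus d L)))) :=
    fun l _ ψ hψ => fockTranslate_mulVec_mem_szSector _ hψ
  have hUK' : ∀ l ∈ tt, ∀ ψ ∈ (szSector (2 * nh) 0 : Submodule ℂ (Fock (Orb (FermionTorus d L)))),
      (Us l)ᴴ *ᵥ ψ ∈ (szSector (2 * nh) 0 : Submodule ℂ (Fock (Orb (FermionTorus d L)))) :=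
    fun l _ ψ hψ => fockTranslate_conjTranspose_mulVec_mem_szSector _ hψ
  have hUU : ∀ l ∈ tt, (Us l)ᴴ * Us l = 1 := fun l _ => fockTranslate_conjTranspose_mul_self _
  -- charge family (charged words as commutators with `N̂` / `S^z`)
  set emb : Orb (PolySite Λ') × Bool → Orb (FermionTorus d L) × Bool :=
    fun p => (Orb.embMap (PolySite.toTorusEmb L hInj') p.1, p.2) with hemb
  set C : γ → Matrix (Finset (Orb (FermionTorus d L))) (Finset (Orb (FermionTorus d L))) ℂ :=
    fun j => if ladderCharge ((cw j).map emb) ≠ 0 then totalNumber else HubbardWave0.spinZ with hC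
  set W : γ → Matrix (Finset (Orb (FermionTorus d L))) (Finset (Orb (FermionTorus d L))) ℂ :=
    fun j => (b j / (if ladderCharge ((cw j).map emb) ≠ 0 then ((ladderCharge ((cw j).map emb) : ℤ) : ℂ)
      else ((ladderSpinCharge ((cw j).map emb) : ℤ) : ℂ) / 2)) • ladderWord ((cw j).map emb) with hW
  have hHc := hamiltonian_isHermitian_and_commute_holds (fermionTorusGraph d L) t U
  have hC1 : ∀ j ∈ u, C j * H = H * C j := by
    intro j _
    by_cases hq : ladderCharge ((cw j).map emb) ≠ 0
    · simp only [hC, hq, ne_eq, not_false_eq_true, if_true]; exact hHc.2.1.symm.eq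
    · simp only [hC, hq, if_false]; exact hHc.2.2.symm.eq
  have hCK : ∀ j ∈ u, ∀ ψ ∈ (szSector (2 * nh) 0 : Submodule ℂ (Fock (Orb (FermionTorus d L)))),
      C j *ᵥ ψ ∈ (szSector (2 * nh) 0 : Submodule ℂ (Fock (Orb (FermionTorus d L)))) := by
    intro j _ ψ hψ
    obtain ⟨hNψ, hSψ⟩ := (mem_szSector_iff _ _ ψ).1 hψ
    by_cases hq : ladderCharge ((cw j).map emb) ≠ 0
    · simp only [hC, hq, ne_eq, not_false_eq_true, if_true]
      rw [totalNumber_mulVec_of_isNParticle hNψ]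
      exact Submodule.smul_mem _ _ hψ
    · simp only [hC, hq, if_false]
      rw [hSψ]
      exact Submodule.smul_mem _ _ hψ
  have hCh : ∀ j, (C j)ᴴ = C j := by
    intro j
    by_cases hq : ladderCharge ((cw j).map emb) ≠ 0
    · simp only [hC, hq, ne_eq, not_false_eq_true, if_true]
      rw [totalNumber_eq_numberDiag_univ]
      exact numberDiag_conjTranspose _
    · simp only [hC, hq, if_false]; exact HubbardWave0.spinZ_isHermitian.eq
  have hCK' : ∀ j ∈ u, ∀ ψ ∈ (szSector (2 * nh) 0 : Submodule ℂ (Fock (Orb (FermionTorus d L)))),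
      (C j)ᴴ *ᵥ ψ ∈ (szSector (2 * nh) 0 : Submodule ℂ (Fock (Orb (FermionTorus d L)))) :=
    fun j hj ψ hψ => by rw [hCh j]; exact hCK j hj ψ hψ
  have hcharged : ∀ j ∈ u, Γ' (b j • ladderWord (cw j)) = C j * W j - W j * C j := by
    intro j hj
    rw [map_smul, hΓ', fermionEmbed_ladderWord]
    have hl : ladderCharge ((cw j).map emb) ≠ 0 ∨ ladderSpinCharge ((cw j).map emb) ≠ 0 := by
      rw [hemb, ladderCharge_map_embMap, ladderSpinCharge_map_embMap]; exact hcw j hj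
    exact smul_ladderWord_eq_commutator_of_charged (b j) _ hl
  -- residual words
  set M : κ'' → Matrix (Finset (Orb (FermionTorus d L))) (Finset (Orb (FermionTorus d L))) ℂ :=
    fun k => ladderWord ((word k).map emb) with hM
  have hMc : ∀ k ∈ w, (M k).IsContraction := fun k _ => by
    rw [hM]; dsimp only; rw [ladderWord_eq_prod]; exact isContraction_prod_ladder _
  -- the identity, pulled back into the torus
  have htorus : X - (c : ℂ) • (1 : Matrix (Finset (Orb (FermionTorus d L))) (Finset (Orb (FermionTorus d L))) ℂ) -
      ∑ σ ∈ (Finset.univ : Finset (Fin 2)), ((μ σ : ℝ) : ℂ) • (D σ - ((ν : ℝ) : ℂ) •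
        (1 : Matrix (Finset (Orb (FermionTorus d L))) (Finset (Orb (FermionTorus d L))) ℂ)) =
      gramForm Λm (fun i => Γ' (O i)) +
        (∑ k ∈ s, (H * Γ' (fermionEmbed (PolySite.incl hΛ) (B k)) - Γ' (fermionEmbed (PolySite.incl hΛ) (B k)) * H) +
          ∑ l ∈ tt, (Us l * Yt l * (Us l)ᴴ - Yt l) +
          ∑ i ∈ (∅ : Finset (Fin 0)), ((0 : Matrix _ _ ℂ) * ((0 : Matrix _ _ ℂ) - (((0 : ℝ) : ℝ) : ℂ) • 1) +
            ((0 : Matrix _ _ ℂ) - (((0 : ℝ) : ℝ) : ℂ) • 1) * (0 : Matrix _ _ ℂ)) +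
          ∑ j ∈ u, (C j * W j - W j * C j)) +
        (∑ m' ∈ ah, ((dc m' : ℝ) : ℂ) • ((Γ' (V m'))ᴴ - Γ' (V m')) + ∑ k ∈ w, a k • M k) := by
    have key := congrArg Γ' hcert
    -- left-hand side
    rw [map_sub, map_sub, map_smul, map_one, map_sum] at key
    have hlhs : ∑ σ : Fin 2, Γ' (((μ σ : ℝ) : ℂ) • (nAt 0 hz σ - ((ν : ℝ) : ℂ) • (1 : FermionOp Λ'))) =
        ∑ σ ∈ (Finset.univ : Finset (Fin 2)), ((μ σ : ℝ) : ℂ) • (D σ - ((ν : ℝ) : ℂ) •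
          (1 : Matrix (Finset (Orb (FermionTorus d L))) (Finset (Orb (FermionTorus d L))) ℂ)) :=
      Finset.sum_congr rfl fun σ _ => by rw [map_smul, map_sub, map_smul, map_one, hDΓ]
    rw [hlhs] at key
    -- right-hand side, family by family
    have h1 : Γ' (∑ k ∈ s, ((hubbardFermionInteraction d t U).localHamiltonian Λ' * fermionEmbed (PolySite.incl hΛ) (B k) -
        fermionEmbed (PolySite.incl hΛ) (B k) * (hubbardFermionInteraction d t U).localHamiltonian Λ')) =
        ∑ k ∈ s, (H * Γ' (fermionEmbed (PolySite.incl hΛ) (B k)) - Γ' (fermionEmbed (PolySite.incl hΛ) (B k)) * H) := by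
      rw [map_sum]
      refine Finset.sum_congr rfl fun k _ => ?_
      rw [hH, hΓ', hubbardTorus_commutator_fermionEmbed L t U hΛ hclosed hInj (B k)]
    have h2 : Γ' (∑ l ∈ tt, (fermionEmbed (PolySite.incl (hsh l)) (fermionEmbed (PolySite.shiftEmb (v l) Λ) (Y l)) -
        fermionEmbed (PolySite.incl hΛ) (Y l))) = ∑ l ∈ tt, (Us l * Yt l * (Us l)ᴴ - Yt l) := by
      rw [map_sum]
      refine Finset.sum_congr rfl fun l _ => ?_
      rw [hUs, hYt, hΓΛ, hΓ']
      exact fermionEmbed_toTorusEmb_shift_sub hΛ (v l) (hsh l) hInj' (Y l)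
    have h3 : Γ' (∑ j ∈ u, b j • ladderWord (cw j)) = ∑ j ∈ u, (C j * W j - W j * C j) := by
      rw [map_sum]
      exact Finset.sum_congr rfl hcharged
    have h4 : Γ' (∑ m' ∈ ah, ((dc m' : ℝ) : ℂ) • ((V m')ᴴ - V m')) =
        ∑ m' ∈ ah, ((dc m' : ℝ) : ℂ) • ((Γ' (V m'))ᴴ - Γ' (V m')) := by
      rw [map_sum]
      refine Finset.sum_congr rfl fun m' _ => ?_
      rw [map_smul, map_sub, hΓ', fermionEmbed_conjTranspose]
    have h5 : Γ' (∑ k ∈ w, a k • ladderWord (word k)) = ∑ k ∈ w, a k • M k := by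
      rw [map_sum]
      refine Finset.sum_congr rfl fun k _ => ?_
      rw [map_smul, hM, hΓ', fermionEmbed_ladderWord]
    rw [hX, key, map_add, map_add, map_add, map_add, map_add, hΓ', fermionEmbed_gramForm, ← hΓ', h1, h2, h3, h4, h5,
      Finset.sum_empty, add_zero]
  -- apply the torus theorem
  have hmain := hubbardTorus_groundEnergyAt_div_ge_of_local_certificate t U hn X hsum
    (Finset.univ : Finset (Fin 2)) μ (fun _ => ν) (fun _ => (nh : ℝ)) D G hDsum hGh hGs hΛm
    (fun i => Γ' (O i)) s (fun k => Γ' (fermionEmbed (PolySite.incl hΛ) (B k))) tt Us Yt hU hUK hUK' hUU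
    (∅ : Finset (Fin 0)) (fun _ => 0) (fun _ => 0) (fun _ => 0) (fun _ => 0)
    (fun i hi => absurd hi (Finset.notMem_empty i)) (fun i hi => absurd hi (Finset.notMem_empty i))
    u C W hC1 hCK hCK' ah dc (fun m' => Γ' (V m')) w a M hMc htorus
  have hs : ∑ σ ∈ (Finset.univ : Finset (Fin 2)), μ σ * ((nh : ℝ) / (L : ℝ) ^ d - ν) =
      (∑ σ : Fin 2, μ σ) * ((nh : ℝ) / (L : ℝ) ^ d - ν) := by rw [Finset.sum_mul]
  rw [hs] at hmain
  exact hmain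

/-! ### Thermodynamic limit (`d = 2`) -/

/-- **Window certificate ⇒ thermodynamic-limit energy density (square lattice).** With the data of
`groundEnergyAt_div_ge_of_window_certificate` in `d = 2` and target density `n ∈ [0, 2)` (density
constraints `n_{0σ} − (n/2)·1`, `U ≥ 0`), the window identity proves
`c − Σₖ ‖aₖ‖ ≤ energyDensity2D t U n`: the finite-torus bound holds on every large torus along
`N_L = 2⌊nL²/2⌋` (`x ↦ x mod L` is eventually injective on the window,
`exists_forall_le_injOn_proj`) and passes to the limit by `energyDensity2D_ge_of_eventually_ge_torus`.
Han 2020 §3 (2D Hubbard model, bootstrap "directly in the thermodynamic limit"); Ruelle 1969 §3.3.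
[cite: Han2020Bootstrap, §3] -/
theorem energyDensity2D_ge_of_window_certificate (t : ℝ) {U : ℝ} (hU : 0 ≤ U) {n : ℝ} (hn0 : 0 ≤ n)
    (hn2 : n < 2)
    {Λ Λ' : Finset (Site 2)} (hΛ : Λ ⊆ Λ')
    (hclosed : ∀ x ∈ Λ, ∀ i : Fin 2, x + unitVec i ∈ Λ' ∧ x - unitVec i ∈ Λ')
    (h0 : thicken ({0} : Finset (Site 2)) 1 ⊆ Λ') (hz : (0 : Site 2) ∈ Λ')
    (μ : Fin 2 → ℝ)
    {m : Type*} [Fintype m] [DecidableEq m] {Λm : Matrix m m ℂ} (hΛm : Λm.PosSemidef)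
    (O : m → FermionOp Λ')
    {κ : Type*} (s : Finset κ) (B : κ → FermionOp Λ)
    {ι : Type*} (tt : Finset ι) (v : ι → Site 2) (hsh : ∀ l, shiftSet (v l) Λ ⊆ Λ') (Y : ι → FermionOp Λ)
    {γ : Type*} (u : Finset γ) (b : γ → ℂ) (cw : γ → List (Orb (PolySite Λ') × Bool))
    (hcw : ∀ j ∈ u, ladderCharge (cw j) ≠ 0 ∨ ladderSpinCharge (cw j) ≠ 0)
    {δ : Type*} (ah : Finset δ) (dc : δ → ℝ) (V : δ → FermionOp Λ')
    {κ'' : Type*} (w : Finset κ'') (a : κ'' → ℂ) (word : κ'' → List (Orb (PolySite Λ') × Bool)) {c : ℝ}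
    (hcert : fermionEmbed (PolySite.incl h0) ((hubbardFermionInteraction 2 t U).meanEnergyObs 1) -
        (c : ℂ) • (1 : FermionOp Λ') -
        ∑ σ : Fin 2, ((μ σ : ℝ) : ℂ) • (nAt 0 hz σ - ((n / 2 : ℝ) : ℂ) • (1 : FermionOp Λ')) =
      gramForm Λm O +
        (∑ k ∈ s, ((hubbardFermionInteraction 2 t U).localHamiltonian Λ' * fermionEmbed (PolySite.incl hΛ) (B k) -
            fermionEmbed (PolySite.incl hΛ) (B k) * (hubbardFermionInteraction 2 t U).localHamiltonian Λ') +
          ∑ l ∈ tt, (fermionEmbed (PolySite.incl (hsh l)) (fermionEmbed (PolySite.shiftEmb (v l) Λ) (Y l)) -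
            fermionEmbed (PolySite.incl hΛ) (Y l)) +
          ∑ j ∈ u, b j • ladderWord (cw j)) +
        (∑ m' ∈ ah, ((dc m' : ℝ) : ℂ) • ((V m')ᴴ - V m') + ∑ k ∈ w, a k • ladderWord (word k))) :
    c - ∑ k ∈ w, ‖a k‖ ≤ ThermodynamicLimit.energyDensity2D t U n := by
  obtain ⟨L₀, hL₀⟩ := exists_forall_le_injOn_proj (thicken Λ' 1)
  refine ThermodynamicLimit.energyDensity2D_ge_of_eventually_ge_torus t hU hn0 hn2
    (μ := (∑ σ : Fin 2, μ σ) / 2) ?_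
  filter_upwards [Filter.eventually_ge_atTop (max L₀ 3)] with L hL
  have hL3 : 3 ≤ L := le_trans (le_max_right _ _) hL
  have hLL : L₀ ≤ L := le_trans (le_max_left _ _) hL
  haveI : NeZero L := ⟨by omega⟩
  set nh : ℕ := ⌊n * (L : ℝ) ^ 2 / 2⌋₊ with hnh
  have hrect : ThermodynamicLimit.rectN n L = 2 * nh := rfl
  have hn : nh ≤ Fintype.card (FermionTorus 2 L) := by
    have h := ThermodynamicLimit.rectN_le_two_mul hn0 hn2.le L
    rw [hrect] at h
    have hcard : Fintype.card (FermionTorus 2 L) = L ^ 2 := by simp [FermionTorus]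
    rw [hcard, sq]
    omega
  have hmain := groundEnergyAt_div_ge_of_window_certificate t U hL3 hn hΛ hclosed h0 hz (hL₀ L hLL) μ (n / 2)
    hΛm O s B tt v hsh Y u b cw hcw ah dc V w a word hcert
  have key : c - ∑ k ∈ w, ‖a k‖ + (∑ σ : Fin 2, μ σ) / 2 * ((((2 * nh : ℕ) : ℝ)) / (L : ℝ) ^ 2 - n) =
      c - ∑ k ∈ w, ‖a k‖ + (∑ σ : Fin 2, μ σ) * ((nh : ℝ) / (L : ℝ) ^ 2 - n / 2) := by
    push_cast
    ring
  rw [hrect, key]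
  exact hmain

end Window


end Literature.MathematicalPhysics.QuantumLattice
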